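import Summits.BirchSwinnertonDyer.BirchSwinnertonDyer.Theorems.EisensteinPrimesMazurMCOnX1RankZeroInterludeResidualGL1OuterConj
import Literature.NumberTheory.EllipticCurves.Castella2018.AnticyclotomicSelmer
import Literature.NumberTheory.GaloisRepresentations.DecompositionGroupOfCompletion
import Literature.NumberTheory.Automorphic.AdicCompletionLocalField
import HarnessLib

/-!
# Crux `MazurMCOnX1RankZero` (item stmt-BirchSwinnertonDyer-19035), line `interlude_with_torsion`, road B (B3):
# the swap permutes Greenberg's conditions above `v`, `v̄`; the core reduction at `S = ∅` (helper 2 of 3)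

Cell `bsd-eis`, LEAD `cruxlead-19035` (g0), stub worker on `stub_residualGL1FinitenessOdd` (skeleton v8); `--supports`
stmt-BirchSwinnertonDyer-19035 as a HELPER.  Continues `…InterludeResidualGL1OuterConj` (the outer action `outerConjH1` /
`cycSwapH1` of `τ ∈ Γ_ℚ` on `H¹(K_∞, M)` for a module with `Γ_ℚ`-provenance).  Here:

* §0 `finite_of_image_finite_of_ker_subset` — abstract: `A, B ≤ X`, `φ : X → X` additive with `φ a = 0 ⇒ a ∈ B` on `A`,
  `A ⊓ B` finite and `φ(A)` finite ⟹ `A` finite (`#A = #ker · #im`).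
* §3 dictionary: `mem_unramifiedKer_iff_resOfLe` (Greenberg–Vatsal's `unramifiedKer H M w` = "dies on `H ⊓ I_{𝔓₀}`",
  `𝔓₀ = adicCompletionPrime`), `mem_strictKer_strictDatum_iff_resOfLe` (Castella's strict condition for `M⁺_w = 0` =
  "dies on `H ⊓ D_{𝔓₀}`"), `forall_conjH1_mem_unramifiedKer_of_strict` (strict at `w` ⟹ unramified at `w`).
* §4 **transport**: `outerConjH1_mem_unramifiedOutside` (`τ ·` carries `H¹(L_Σ/K̄^H, M)` to `H¹(L_{τ̄Σ}/K̄^H, M)`) and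
  `forall_conjH1_outerConjH1_mem_strictKer` (strict above `w` ⟹ strict above `τ̄ • w` after `τ ·`).
* §6 **core reduction at `S = ∅`** (`finite_datumStrictSelmer_bdpData_empty_of_inputs`): for the cyclotomic tower of a
  Galois `K/ℚ` with `p = v v̄` the only places above `p`, a `Γ_ℚ`-module `M` restricted to `Γ_K` and `τ ∈ Γ_ℚ` with
  `τ̄ v̄ = v`: `T_τ(Sel_{v̄-str}^∅) ⊆ Sel_{v-str}^∅` (`cycSwapH1_mem_datumStrictSelmer`), `Sel_{v̄} ∩ Sel_v ⊆`
  everywhere-unramified, so `Sel_{v̄-str}^∅(K_∞, M)` is finite as soon as [Unr] the everywhere-unramified classes of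
  `H¹(K_∞, M)` are finite and [Even] `(1 ± T_τ)(H¹(K_p/K_∞, M))` is finite for one sign — Greenberg's mechanism
  (LNM 1716, Lemma 5.9: for `p` odd and an EVEN character `Θ`, `H¹(ℚ_Σ/ℚ_∞, Θ)` is finite; proof of Prop. 5.10) read
  over `K_∞ ⊃ ℚ_∞` through the `±`-decomposition under `Gal(K_∞/ℚ_∞)`.

HONEST FRAMING.  Bookkeeping over the tree's Selmer-condition subgroups; no definition, no named fact, no `sorry`; [Unr]
and [Even] are displayed hypotheses; nothing about BSD, Mazur's main conjecture or IMC2 is asserted.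

References: R. Greenberg, LNM 1716 (1999), §5, Lemma 5.9, Prop. 5.10 [GreenbergLNM1716]; R. Greenberg, V. Vatsal, Invent.
Math. 142 (2000) §2 [GreenbergVatsal2000]; F. Castella, Camb. J. Math. 6 (2018) Def. 2.2 [Castella2018]; R. Greenberg, Adv.
Stud. Pure Math. 17 (1989) §1 [Greenberg1989]; J. Neukirch, *Algebraic Number Theory* I §9, II §9 [NeukirchANT1999].
-/

set_option linter.dupNamespace false
set_option autoImplicit false

noncomputable section

open scoped Classical Pointwise

namespace Summit.BirchSwinnertonDyer.BirchSwinnertonDyer.Theorems.InterludeWithTorsion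

open NumberField IsDedekindDomain Field
open Literature.NumberTheory.EllipticCurves Literature.NumberTheory.EllipticCurves.GreenbergSelmer
  Literature.NumberTheory.EllipticCurves.GreenbergVatsal2000 Literature.NumberTheory.GaloisRepresentations
  Literature.NumberTheory.EllipticCurves.Castella2018

/-! ## §0 An abstract finiteness lemma -/

/-- test. [folklore] -/
theorem finite_of_image_finite_of_ker_subset {X : Type*} [AddCommGroup X] (A B : AddSubgroup X) (φ : X →+ X)
    (hφ : ∀ a ∈ A, φ a = 0 → a ∈ B) (hAB : ((A ⊓ B : AddSubgroup X) : Set X).Finite)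
    (hfin : (φ '' (A : Set X)).Finite) : (A : Set X).Finite := by
  let ψ : A →+ X := φ.comp A.subtype
  haveI hK : Finite ψ.ker := by
    haveI : Finite (A ⊓ B : AddSubgroup X) := hAB.to_subtype
    refine Finite.of_injective (fun c : ψ.ker ↦
      (⟨((c : A) : X), AddSubgroup.mem_inf.mpr ⟨(c : A).2, hφ _ (c : A).2 c.2⟩⟩ : (A ⊓ B : AddSubgroup X))) ?_
    intro a b h
    have h' := congrArg (fun x : (A ⊓ B : AddSubgroup X) ↦ (x : X)) h
    exact Subtype.ext (Subtype.ext h')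
  haveI hR : Finite ψ.range := by
    have : (ψ.range : Set X) = φ '' (A : Set X) := by
      ext x
      simp only [AddMonoidHom.coe_range, Set.mem_range, Set.mem_image, SetLike.mem_coe, ψ,
        AddMonoidHom.coe_comp, AddSubgroup.coe_subtype, Function.comp_apply, Subtype.exists,
        exists_prop]
    have hfin' : ((ψ.range : Set X)).Finite := this ▸ hfin
    exact hfin'.to_subtype
  haveI : Finite (A ⧸ ψ.ker) := Finite.of_equiv _ (QuotientAddGroup.quotientKerEquivRange ψ).symm.toEquiv
  have : Finite A := by
    apply Nat.finite_of_card_ne_zero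
    rw [ψ.ker.card_eq_card_quotient_mul_card_addSubgroup]
    exact mul_ne_zero (Nat.card_pos (α := A ⧸ ψ.ker)).ne' (Nat.card_pos (α := ψ.ker)).ne'
  exact Set.toFinite _

/-! ## §3 Inertia and decomposition groups: the tree's `unramifiedKer` and Castella's strict condition -/

section Bridges

variable {L : Type} [Field L] [NumberField L]
variable (H : Subgroup (absoluteGaloisGroup L))
variable (M : Type) [AddCommGroup M] [DistribMulAction (absoluteGaloisGroup L) M] [TopologicalSpace M]
  [DiscreteTopology M]

omit [NumberField L] in
/-- `I_{σ • 𝔓} = σ I_𝔓 σ⁻¹`, membership form. [cite: NeukirchANT1999, Ch. I §9 Prop. (9.4)] -/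
theorem mem_inertia_smul_iff (σ : absoluteGaloisGroup L) (𝔓 : Ideal (absIntegers (𝓞 L) L))
    (g : absoluteGaloisGroup L) :
    g ∈ (σ • 𝔓).inertia (absoluteGaloisGroup L) ↔ σ⁻¹ * g * σ ∈ 𝔓.inertia (absoluteGaloisGroup L) := by
  rw [← Ideal.conj_mem_inertia_smul_iff 𝔓 σ (σ⁻¹ * g * σ),
    show σ * (σ⁻¹ * g * σ) * σ⁻¹ = g by group]

omit [NumberField L] in
/-- `D_{σ • 𝔓} = σ D_𝔓 σ⁻¹`, membership form. [cite: NeukirchANT1999, Ch. I §9 (9.5)] -/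
theorem mem_decompositionSubgroup_smul_iff (σ : absoluteGaloisGroup L) (𝔓 : Ideal (absIntegers (𝓞 L) L))
    (g : absoluteGaloisGroup L) :
    g ∈ (σ • 𝔓).decompositionSubgroup (absoluteGaloisGroup L) ↔
      σ⁻¹ * g * σ ∈ 𝔓.decompositionSubgroup (absoluteGaloisGroup L) := by
  rw [Ideal.decompositionSubgroup_smul, Subgroup.mem_pointwise_smul_iff_inv_smul_mem, ← map_inv,
    MulAut.smul_def, MulAut.conj_apply, inv_inv]

/-- **`unramifiedKer` is "dies on `H ⊓ I_{𝔓₀}`"** for the prime `𝔓₀ = adicCompletionPrime L w` of the chosen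
embedding (`I_{𝔓₀} = res(I_{L_w})`, `inertia_adicCompletionPrime_eq_map_absInertia`).
[cite: NeukirchANT1999, Ch. II §9 Prop. (9.6)] [cite: GreenbergVatsal2000, §2 p. 17] -/
theorem mem_unramifiedKer_iff_resOfLe (w : HeightOneSpectrum (𝓞 L)) (c : subgroupH1 H M) :
    c ∈ GreenbergVatsal2000.unramifiedKer H M w ↔
      resOfLe M (inf_le_left : H ⊓ (adicCompletionPrime L w).inertia (absoluteGaloisGroup L) ≤ H) c = 0 := by
  obtain ⟨z, rfl⟩ := oneCocycleClass_surjective _ c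
  have hI : GreenbergSelmer.inertia w = (adicCompletionPrime L w).inertia (absoluteGaloisGroup L) := by
    rw [GreenbergSelmer.inertia, ← inertia_adicCompletionPrime_eq_map_absInertia]
  rw [GreenbergVatsal2000.unramifiedKer, AddMonoidHom.mem_ker,
    CocycleCriteria.resH1Hom_oneCocycleClass_eq_zero_iff, resOfLe_inf_oneCocycleClass_eq_zero_iff]
  constructor
  · rintro ⟨a, ha⟩
    refine ⟨a, fun x hx hxI ↦ ?_⟩
    rw [← hI] at hxI
    have hxD : x ∈ decomp w := GreenbergSelmer.inertia_le_decomp w hxI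
    have key := ha ⟨⟨x, hxD⟩, (mem_inertiaIn_iff H w _).2 ⟨hx, hxI⟩⟩
    exact key
  · rintro ⟨a, ha⟩
    refine ⟨a, fun y ↦ ?_⟩
    obtain ⟨hyH, hyI⟩ := (mem_inertiaIn_iff H w y).1 y.2
    rw [hI] at hyI
    exact ha _ hyH hyI

/-- **Castella's strict condition at `w` (datum `M⁺_w = 0`) is "dies on `H ⊓ D_{𝔓₀}`"**
(`D_{𝔓₀} = res(Γ_{L_w})`, `decompositionSubgroup_adicCompletionPrime_eq_range`; `M ↠ M ⧸ 0` is bijective).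
[cite: Castella2018, §2.1 Def. 2.1–2.2 (arXiv:1704.06608 p. 5)] [cite: Greenberg1989, §1 p. 98] -/
theorem mem_strictKer_strictDatum_iff_resOfLe (w : HeightOneSpectrum (𝓞 L)) (c : subgroupH1 H M) :
    c ∈ (AcSelmer.strictDatum M w).strictKer H ↔
      resOfLe M (inf_le_left : H ⊓ (adicCompletionPrime L w).decompositionSubgroup (absoluteGaloisGroup L) ≤ H)
        c = 0 := by
  obtain ⟨z, rfl⟩ := oneCocycleClass_surjective _ c
  set N := AcSelmer.strictDatum M w
  have hD : decomp w = (adicCompletionPrime L w).decompositionSubgroup (absoluteGaloisGroup L) := by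
    rw [GreenbergSelmer.decomp, ← decompositionSubgroup_adicCompletionPrime_eq_range]
  have hinj : Function.Injective N.grMk := by
    intro a b hab
    have h : a - b ∈ N.grMk.ker := by rw [AddMonoidHom.mem_ker, map_sub, sub_eq_zero]; exact hab
    rw [LocalDatum.ker_grMk] at h
    exact sub_eq_zero.mp (AddSubgroup.mem_bot.mp h)
  rw [LocalDatum.mem_strictKer_iff, LocalDatum.strictMap, CocycleCriteria.resH1Hom_oneCocycleClass_eq_zero_iff,
    resOfLe_inf_oneCocycleClass_eq_zero_iff]
  constructor
  · rintro ⟨n, hn⟩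
    obtain ⟨a, rfl⟩ := N.grMk_surjective n
    refine ⟨a, fun x hx hxD ↦ hinj ?_⟩
    rw [← hD] at hxD
    have key := hn ⟨⟨x, hxD⟩, (mem_decompIn_iff H w _).2 hx⟩
    rw [Subgroup.smul_def, LocalDatum.smul_grMk, ← map_sub] at key
    exact key
  · rintro ⟨a, ha⟩
    refine ⟨N.grMk a, fun y ↦ ?_⟩
    have hyH := (mem_decompIn_iff H w y).1 y.2
    have hyD : (((y : decomp w) : absoluteGaloisGroup L)) ∈
        (adicCompletionPrime L w).decompositionSubgroup (absoluteGaloisGroup L) := hD ▸ (y : decomp w).2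
    rw [Subgroup.smul_def, LocalDatum.smul_grMk, ← map_sub]
    exact congrArg N.grMk (ha _ hyH hyD)

omit [NumberField L] in
/-- Dying on `H ⊓ J` implies dying on `H ⊓ J'` for `J' ≤ J` (transitivity of restriction). [folklore] -/
theorem resOfLe_inf_eq_zero_of_le {J J' : Subgroup (absoluteGaloisGroup L)} (hJ : J' ≤ J) (c : subgroupH1 H M)
    (hc : resOfLe M (inf_le_left : H ⊓ J ≤ H) c = 0) :
    resOfLe M (inf_le_left : H ⊓ J' ≤ H) c = 0 := by
  have hle : H ⊓ J' ≤ H ⊓ J := inf_le_inf_left H hJ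
  have e : resOfLe M (inf_le_left : H ⊓ J' ≤ H) = (resOfLe M hle).comp (resOfLe M (inf_le_left : H ⊓ J ≤ H)) :=
    (resOfLe_comp_holds hle inf_le_left).symm
  rw [e, AddMonoidHom.comp_apply, hc, map_zero]

/-- A class all of whose conjugates satisfy Castella's strict condition at `w` has all its conjugates
unramified at `w` (`I_𝔓 ≤ D_𝔓` at every prime above `w`). [cite: Greenberg1989, §1 p. 98] -/
theorem forall_conjH1_mem_unramifiedKer_of_strict [H.Normal] (w : HeightOneSpectrum (𝓞 L)) (c : subgroupH1 H M)
    (hc : ∀ σ : absoluteGaloisGroup L, conjH1 H M σ c ∈ (AcSelmer.strictDatum M w).strictKer H) :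
    ∀ σ : absoluteGaloisGroup L, conjH1 H M σ c ∈ GreenbergVatsal2000.unramifiedKer H M w := by
  simp only [mem_strictKer_strictDatum_iff_resOfLe] at hc
  rw [forall_resOfLe_conjH1_eq_zero_iff H M (fun 𝔓 ↦ 𝔓.decompositionSubgroup (absoluteGaloisGroup L))
    (mem_decompositionSubgroup_smul_iff) (adicCompletionPrime_mem_primesAbove L w)] at hc
  simp only [mem_unramifiedKer_iff_resOfLe]
  rw [forall_resOfLe_conjH1_eq_zero_iff H M (fun 𝔓 ↦ 𝔓.inertia (absoluteGaloisGroup L))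
    (mem_inertia_smul_iff) (adicCompletionPrime_mem_primesAbove L w)]
  exact fun 𝔓 h𝔓 ↦ resOfLe_inf_eq_zero_of_le H M (Ideal.inertia_le_decompositionSubgroup _ _) c (hc 𝔓 h𝔓)

end Bridges

/-! ## §4 The outer action permutes the local conditions along `w ↦ τ̄ • w` -/

section Transport

variable {F L : Type} [Field F] [Field L] [NumberField L] [Algebra F L] [IsGalois F L]
variable (H : Subgroup (absoluteGaloisGroup L)) [H.Normal]
  (hH : ∀ (τ : absoluteGaloisGroup F) (x : absoluteGaloisGroup L), x ∈ H → absGaloisOuterConj F L τ x ∈ H)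
variable (M : Type) [AddCommGroup M] [DistribMulAction (absoluteGaloisGroup F) M]
  [DistribMulAction (absoluteGaloisGroup L) M] [TopologicalSpace M] [DiscreteTopology M]
  (hM : ∀ (σ : absoluteGaloisGroup L) (m : M), σ • m = absGaloisRestrict F L σ • m)

/-- **`θ_τ(D_𝔔) = D_{τ ⋆ 𝔔}`**: the outer action carries decomposition groups to decomposition groups
(companion of the tree's `absGaloisOuterConj_mem_inertia_iff`). [cite: NeukirchANT1999, Ch. I §9 (9.5)] -/
theorem absGaloisOuterConj_mem_decompositionSubgroup_iff (τ : absoluteGaloisGroup F)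
    (𝔔 : Ideal (absIntegers (𝓞 L) L)) (σ : absoluteGaloisGroup L) :
    absGaloisOuterConj F L τ σ ∈ (outerConjIdeal τ 𝔔).decompositionSubgroup (absoluteGaloisGroup L) ↔
      σ ∈ 𝔔.decompositionSubgroup (absoluteGaloisGroup L) := by
  rw [← comap_decompositionSubgroup_comap_absIntegersMap F L (outerConjIdeal τ 𝔔),
    ← comap_decompositionSubgroup_comap_absIntegersMap F L 𝔔, Subgroup.mem_comap, Subgroup.mem_comap]
  change absGaloisRestrict F L (absGaloisOuterConj F L τ σ) ∈ _ ↔ absGaloisRestrict F L σ ∈ _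
  rw [comap_outerConjIdeal, absGaloisRestrict_absGaloisOuterConj, mem_decompositionSubgroup_smul_iff,
    show τ⁻¹ * (τ * absGaloisRestrict F L σ * τ⁻¹) * τ = absGaloisRestrict F L σ by group]

omit [NumberField L] [IsGalois F L] in
/-- A Galois automorphism fixes the rational prime `p`: `p ∈ (g • w)` iff `p ∈ w`. [folklore] -/
theorem natCast_mem_smul_asIdeal_iff (g : L ≃ₐ[F] L) (w : HeightOneSpectrum (𝓞 L)) (p : ℕ) :
    ((p : ℕ) : 𝓞 L) ∈ (g • w).asIdeal ↔ ((p : ℕ) : 𝓞 L) ∈ w.asIdeal := by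
  have hp : g • ((p : ℕ) : 𝓞 L) = p := map_natCast (MulSemiringAction.toRingHom _ (𝓞 L) g) p
  rw [← Literature.NumberTheory.Automorphic.HeightOneSpectrum.smul_mem_smul_asIdeal_iff g w, hp]

include hM in
/-- **The outer action carries `H¹(L_Σ/K̄^H, M)` to `H¹(L_{τ̄Σ}/K̄^H, M)`**: if every conjugate of `c` is
unramified at every finite `w ∉ S`, `w ∤ p`, then every conjugate of `τ · c` is unramified at every finite
`u ∉ τ̄ • S`, `u ∤ p`. [cite: GreenbergVatsal2000, §2 pp. 16–17] [cite: NeukirchANT1999, Ch. I §9 Prop. (9.4)] -/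
theorem outerConjH1_mem_unramifiedOutside (p : ℕ) (S : Set (HeightOneSpectrum (𝓞 L)))
    (τ : absoluteGaloisGroup F) (c : subgroupH1 H M) (hc : c ∈ unramifiedOutside H M p S) :
    outerConjH1 H hH M hM τ c ∈ unramifiedOutside H M p ((fun w ↦ absGaloisQuot F L τ • w) '' S) := by
  rw [mem_unramifiedOutside_iff] at hc ⊢
  intro u hu hpu
  set w : HeightOneSpectrum (𝓞 L) := (absGaloisQuot F L τ)⁻¹ • u with hw
  have hu' : absGaloisQuot F L τ • w = u := smul_inv_smul _ _
  have hwS : w ∉ S := fun h ↦ hu ⟨w, h, hu'⟩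
  have hpw : ((p : ℕ) : 𝓞 L) ∉ w.asIdeal := by
    rwa [hw, natCast_mem_smul_asIdeal_iff]
  have h1 := hc w hwS hpw
  simp only [mem_unramifiedKer_iff_resOfLe] at h1 ⊢
  rw [forall_resOfLe_conjH1_eq_zero_iff H M (fun 𝔓 ↦ 𝔓.inertia (absoluteGaloisGroup L))
    (mem_inertia_smul_iff) (adicCompletionPrime_mem_primesAbove L w)] at h1
  rw [forall_resOfLe_conjH1_eq_zero_iff H M (fun 𝔓 ↦ 𝔓.inertia (absoluteGaloisGroup L))
    (mem_inertia_smul_iff) (adicCompletionPrime_mem_primesAbove L u)]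
  intro 𝔓 h𝔓
  rw [← hu'] at h𝔓
  exact resOfLe_outerConjH1_eq_zero H M hH hM (fun 𝔓 ↦ 𝔓.inertia (absoluteGaloisGroup L))
    (absGaloisOuterConj_mem_inertia_iff) τ c h1 h𝔓

include hM in
/-- **The outer action carries the strict condition above `w` to the strict condition above `τ̄ • w`**:
if every conjugate of `c` satisfies Castella's strict condition at `w` (dies on every decomposition group
above `w`), then every conjugate of `τ · c` satisfies it at `τ̄ • w`.
[cite: Castella2018, Def. 2.2 (arXiv:1704.06608 p. 5)] [cite: NeukirchANT1999, Ch. I §9 (9.5)] -/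
theorem forall_conjH1_outerConjH1_mem_strictKer (τ : absoluteGaloisGroup F) (w : HeightOneSpectrum (𝓞 L))
    (c : subgroupH1 H M) (hc : ∀ σ : absoluteGaloisGroup L, conjH1 H M σ c ∈ (AcSelmer.strictDatum M w).strictKer H) :
    ∀ σ : absoluteGaloisGroup L, conjH1 H M σ (outerConjH1 H hH M hM τ c) ∈
      (AcSelmer.strictDatum M (absGaloisQuot F L τ • w)).strictKer H := by
  simp only [mem_strictKer_strictDatum_iff_resOfLe] at hc ⊢
  rw [forall_resOfLe_conjH1_eq_zero_iff H M (fun 𝔓 ↦ 𝔓.decompositionSubgroup (absoluteGaloisGroup L))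
    (mem_decompositionSubgroup_smul_iff) (adicCompletionPrime_mem_primesAbove L w)] at hc
  rw [forall_resOfLe_conjH1_eq_zero_iff H M (fun 𝔓 ↦ 𝔓.decompositionSubgroup (absoluteGaloisGroup L))
    (mem_decompositionSubgroup_smul_iff) (adicCompletionPrime_mem_primesAbove L _)]
  intro 𝔓 h𝔓
  exact resOfLe_outerConjH1_eq_zero H M hH hM (fun 𝔓 ↦ 𝔓.decompositionSubgroup (absoluteGaloisGroup L))
    (absGaloisOuterConj_mem_decompositionSubgroup_iff) τ c hc h𝔓

end Transport

/-! ## §6 The residual Greenberg Selmer group over `K_∞^{cyc}`: finiteness from the three inputs -/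

section Core

variable {K : Type} [Field K] [NumberField K] [IsGalois ℚ K] {p : ℕ} [Fact p.Prime]
variable (κ : ZpExtension K p) (hκ : κ.IsCyclotomic)
variable (M : Type) [AddCommGroup M] [DistribMulAction (absoluteGaloisGroup ℚ) M]
  [DistribMulAction (absoluteGaloisGroup K) M] [TopologicalSpace M] [DiscreteTopology M]
  (hM : ∀ (σ : absoluteGaloisGroup K) (m : M), σ • m = absGaloisRestrict ℚ K σ • m)

/-- **The swap carries `Sel_{v̄-str}^∅` into `Sel_{v-str}^∅`** when `τ̄ • v̄ = v` and `v, v̄` are the only places above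
`p`: Greenberg's strict/relaxed datum (`bdpData M p v̄`: strict at `v̄`, nothing at `v`) goes to the swapped datum.
[cite: GreenbergLNM1716, §5, proof of Prop. 5.10] [cite: Castella2018, Def. 2.2 (arXiv:1704.06608 p. 5)] -/
theorem cycSwapH1_mem_datumStrictSelmer {v vbar : HeightOneSpectrum (𝓞 K)}
    (hvbar : ((p : ℕ) : 𝓞 K) ∈ vbar.asIdeal) (τ : absoluteGaloisGroup ℚ) (hτ : absGaloisQuot ℚ K τ • vbar = v)
    {c : subgroupH1 κ.kerSubgroup M}
    (hc : c ∈ datumStrictSelmer κ.kerSubgroup M p (AcSelmer.bdpData M p vbar) ∅) :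
    cycSwapH1 κ hκ M hM τ c ∈ datumStrictSelmer κ.kerSubgroup M p (AcSelmer.bdpData M p v) ∅ := by
  rw [mem_datumStrictSelmer_iff] at hc ⊢
  obtain ⟨hunr, hstr⟩ := hc
  refine ⟨?_, fun w hw σ ↦ ?_⟩
  · have h := outerConjH1_mem_unramifiedOutside κ.kerSubgroup (absGaloisOuterConj_mem_kerSubgroup κ hκ) M hM p ∅ τ
      c hunr
    rwa [Set.image_empty] at h
  · by_cases hwv : w = v
    · subst hwv
      rw [AcSelmer.bdpData_self]
      have h1 : ∀ σ : absoluteGaloisGroup K,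
          conjH1 κ.kerSubgroup M σ c ∈ (AcSelmer.strictDatum M vbar).strictKer κ.kerSubgroup := fun σ ↦ by
        have := hstr vbar hvbar σ
        rwa [AcSelmer.bdpData_self] at this
      have h2 := forall_conjH1_outerConjH1_mem_strictKer κ.kerSubgroup (absGaloisOuterConj_mem_kerSubgroup κ hκ)
        M hM τ vbar c h1 σ
      rwa [hτ] at h2
    · rw [AcSelmer.bdpData_of_ne p v hw hwv, AcSelmer.strictKer_relaxedDatum_eq_top]
      exact AddSubgroup.mem_top _

omit [IsGalois ℚ K] [DistribMulAction (absoluteGaloisGroup ℚ) M] in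
/-- A class in both `Sel_{v̄-str}^∅` and `Sel_{v-str}^∅` is unramified everywhere (all conjugates, all finite places),
provided `v, v̄` are the only places above `p`. [cite: Greenberg1989, §1 p. 98] [cite: GreenbergVatsal2000, §2 p. 17] -/
theorem forall_mem_unramifiedKer_of_mem_inf {v vbar : HeightOneSpectrum (𝓞 K)}
    (hv : ((p : ℕ) : 𝓞 K) ∈ v.asIdeal) (hvbar : ((p : ℕ) : 𝓞 K) ∈ vbar.asIdeal)
    (hSp : ∀ w : HeightOneSpectrum (𝓞 K), ((p : ℕ) : 𝓞 K) ∈ w.asIdeal → w = v ∨ w = vbar)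
    {c : subgroupH1 κ.kerSubgroup M}
    (hA : c ∈ datumStrictSelmer κ.kerSubgroup M p (AcSelmer.bdpData M p vbar) ∅)
    (hB : c ∈ datumStrictSelmer κ.kerSubgroup M p (AcSelmer.bdpData M p v) ∅) :
    ∀ (w : HeightOneSpectrum (𝓞 K)) (σ : absoluteGaloisGroup K),
      conjH1 κ.kerSubgroup M σ c ∈ GreenbergVatsal2000.unramifiedKer κ.kerSubgroup M w := by
  intro w σ
  rw [mem_datumStrictSelmer_iff] at hA hB
  by_cases hpw : ((p : ℕ) : 𝓞 K) ∈ w.asIdeal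
  · rcases hSp w hpw with rfl | rfl
    · refine forall_conjH1_mem_unramifiedKer_of_strict κ.kerSubgroup M w c (fun σ ↦ ?_) σ
      have := hB.2 w hpw σ
      rwa [AcSelmer.bdpData_self] at this
    · refine forall_conjH1_mem_unramifiedKer_of_strict κ.kerSubgroup M w c (fun σ ↦ ?_) σ
      have := hA.2 w hpw σ
      rwa [AcSelmer.bdpData_self] at this
  · exact (mem_unramifiedOutside_iff _).1 hA.1 w (Set.notMem_empty w) hpw σ

/-- **Core reduction at `S = ∅`.**  For the cyclotomic tower `K_∞/K` (`K/ℚ` Galois), `p = v v̄` with `v, v̄` the only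
places above `p`, a `Γ_ℚ`-module `M` restricted to `Γ_K`, and `τ ∈ Γ_ℚ` with `τ̄ • v̄ = v`: if
[Unr] the everywhere-unramified classes of `H¹(K_∞, M)` form a finite set, and
[Even] the image of `H¹(K_{p}/K_∞, M)` (classes unramified outside `p`) under `1 + T_τ` or under `1 − T_τ` is finite,
then Greenberg's residual Selmer group `Sel_{v̄-str, v-rel}^∅(K_∞, M)` is finite.  Mechanism: `T_τ(Sel_{v̄}) ⊆ Sel_v`,
so the kernel of `1 ± T_τ` on `Sel_{v̄}` lies in `Sel_{v̄} ∩ Sel_v ⊆` everywhere-unramified.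
[cite: GreenbergLNM1716, §5, Lemma 5.9 and proof of Prop. 5.10] -/
theorem finite_datumStrictSelmer_bdpData_empty_of_inputs {v vbar : HeightOneSpectrum (𝓞 K)}
    (hv : ((p : ℕ) : 𝓞 K) ∈ v.asIdeal) (hvbar : ((p : ℕ) : 𝓞 K) ∈ vbar.asIdeal)
    (hSp : ∀ w : HeightOneSpectrum (𝓞 K), ((p : ℕ) : 𝓞 K) ∈ w.asIdeal → w = v ∨ w = vbar)
    (τ : absoluteGaloisGroup ℚ) (hτ : absGaloisQuot ℚ K τ • vbar = v)
    (hUnr : {c : subgroupH1 κ.kerSubgroup M | ∀ (w : HeightOneSpectrum (𝓞 K)) (σ : absoluteGaloisGroup K),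
      conjH1 κ.kerSubgroup M σ c ∈ GreenbergVatsal2000.unramifiedKer κ.kerSubgroup M w}.Finite)
    (hEven : ((fun c ↦ c + cycSwapH1 κ hκ M hM τ c) ''
        (unramifiedOutside κ.kerSubgroup M p ∅ : Set (subgroupH1 κ.kerSubgroup M))).Finite ∨
      ((fun c ↦ c - cycSwapH1 κ hκ M hM τ c) ''
        (unramifiedOutside κ.kerSubgroup M p ∅ : Set (subgroupH1 κ.kerSubgroup M))).Finite) :
    (datumStrictSelmer κ.kerSubgroup M p (AcSelmer.bdpData M p vbar) ∅ :
      Set (subgroupH1 κ.kerSubgroup M)).Finite := by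
  set A := datumStrictSelmer κ.kerSubgroup M p (AcSelmer.bdpData M p vbar) ∅ with hAdef
  set B := datumStrictSelmer κ.kerSubgroup M p (AcSelmer.bdpData M p v) ∅ with hBdef
  set T := cycSwapH1 κ hκ M hM τ with hTdef
  have hT : ∀ a ∈ A, T a ∈ B := fun a ha ↦ cycSwapH1_mem_datumStrictSelmer κ hκ M hM hvbar τ hτ ha
  have hAB : ((A ⊓ B : AddSubgroup (subgroupH1 κ.kerSubgroup M)) : Set (subgroupH1 κ.kerSubgroup M)).Finite := by
    refine hUnr.subset fun c hc ↦ ?_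
    obtain ⟨hcA, hcB⟩ := AddSubgroup.mem_inf.mp hc
    exact forall_mem_unramifiedKer_of_mem_inf κ M hv hvbar hSp hcA hcB
  have hAU : (A : Set (subgroupH1 κ.kerSubgroup M)) ⊆ unramifiedOutside κ.kerSubgroup M p ∅ :=
    fun c hc ↦ ((mem_datumStrictSelmer_iff c).1 hc).1
  rcases hEven with hfin | hfin
  · refine finite_of_image_finite_of_ker_subset A B (AddMonoidHom.id _ + T) (fun a ha h0 ↦ ?_) hAB
      (hfin.subset (Set.image_mono hAU))
    have h0' : a + T a = 0 := h0
    rw [add_eq_zero_iff_eq_neg] at h0'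
    rw [h0']
    exact B.neg_mem (hT a ha)
  · refine finite_of_image_finite_of_ker_subset A B (AddMonoidHom.id _ - T) (fun a ha h0 ↦ ?_) hAB
      (hfin.subset (Set.image_mono hAU))
    have h0' : a - T a = 0 := h0
    rw [sub_eq_zero] at h0'
    rw [h0']
    exact hT a ha

end Core

end Summit.BirchSwinnertonDyer.BirchSwinnertonDyer.Theorems.InterludeWithTorsion

end
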